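import Literature.Geometry.Lorentzian.VisibleIncompleteNullRay
import Literature.Geometry.Lorentzian.RedShiftedHorizon
import Literature.Geometry.Lorentzian.Volume
import HarnessLib

/-!
# The black-hole region, the future event horizon and its cuts, without a conformal boundary
(definition item `defn-EventHorizonCuts` for route `FinalStateConjecture/MergerLatticeBudget`,
items `LeafBudgetLaws` / `HorizonAreaBudget`; trunk G08 = T-LORENTZ, gr.S16)

Let `(M, g, τ)` be a time-oriented Lorentzian manifold developing from data on `ι : X → M` with
future unit normal `N` — the setting of `NullInfinity` (Christodoulou's normalised future null rays
`IsNormalisedNullRayFrom`, complete `𝓘⁺` in the sojourn form) and of `VisibleIncompleteNullRay`,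
which renders the **past of future null infinity `J⁻(𝓘⁺) ∩ M` intrinsically** as the *visible
region* `LorentzianMetric.visibleRegion g τ ι N`: the union of the chronological pasts
`I⁻(δ(s ∩ [0, ∞)))` of the nonnegative-parameter halves of all *future-complete* normalised null
rays `δ` from the data hypersurface (the ideal endpoint of a complete normalised ray standing for
a point of `𝓘⁺`; Dafermos–Rodnianski, arXiv:0811.0354, §2.5.4: "if `𝓘⁺` is indeed complete, we
can define the black hole region as the complement in `M` of `J⁻(𝓘⁺)`"). On this file builds the
classical black-hole vocabulary of Hawking–Ellis, §9.2 and Wald, §12.1, with no conformal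
completion anywhere:

* `LorentzianMetric.completeNullRayRegion g τ ι N` — the union of the nonnegative halves of the
  future-complete normalised null rays from the data, the intrinsic stand-in for `𝓘⁺`; its
  chronological past **is** the visible region (`chronologicalPast_completeNullRayRegion`, proved).
* `LorentzianMetric.blackHoleRegion g τ ι N := (visibleRegion)ᶜ` — `𝓑 = M ∖ J⁻(𝓘⁺)`
  (Wald (12.1.2)).
* `LorentzianMetric.futureEventHorizon g τ ι N := frontier visibleRegion` — `𝓗⁺ = J̇⁻(𝓘⁺) = ∂𝓑`
  (Wald (12.1.3), Hawking–Ellis p. 312).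
* `LorentzianMetric.outerRegion g τ ι N := J⁺(range ι) ∩ visibleRegion` — the future domain of
  outer communications `J⁺(ι X) ∩ J⁻(𝓘⁺)`; it is `Summit.FinalStateConjecture.exteriorOf 𝒟 U`
  at `U = completeNullRayRegion` (`outerRegion_eq`).
* `LorentzianMetric.horizonCut g τ ι N Σ := 𝓗⁺ ∩ Σ` — the **cut** of the horizon by a set `Σ`
  (a Cauchy slice `𝒮(τ)`, a leaf): Hawking–Ellis' `∂ℬ(τ)`, CDGH's `S = Σ ∩ 𝓗`.
* `LorentzianMetric.horizonCutArea g τ ι N f hpb hf` — the **area of the cut by a spacelike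
  hypersurface** `f : N' → M` (a spacelike immersion): the `2`-dimensional Euclidean-normalised
  Hausdorff measure (`area`, `Volume.lean`) of `f ⁻¹(𝓗⁺) ⊆ N'` for the length metric of the induced
  Riemannian metric `f^* g` (`inducedRiemannianMetric`, `Hypersurface.lean`) — exactly the area
  `Ar(S) = ℌ^{n-1}_h(S)` of Chruściel–Delay–Galloway–Howard, §3, (3.9), which needs no
  differentiability of `𝓗⁺` (their Prop. 3.3: `Σ ∩ 𝓗` is Borel).
* The horizon regularity vocabulary of Chruściel–Delay–Galloway–Howard, §2, in which their area
  theorem (Thm. 1.1, Thm. 6.1) is stated: `IsTopologicalHypersurface`,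
  `LorentzianMetric.IsFutureNullGeodesicallyRuled`, `LorentzianMetric.HasFutureCompleteGenerators`
  (hypothesis b) of Thm. 1.1), `LorentzianMetric.IsFutureHorizon` (closed, achronal, ruled
  topological hypersurface).
* `DataEmbedding.blackHoleRegion / futureEventHorizon / outerRegion / completeNullRayRegion /
  horizonCut / horizonCutArea` — the same for a data embedding or Cauchy development
  `𝒟 = (M, g, τ, ι, ν)` of an initial data set (`CauchyDevelopment`, `VacuumCauchyDevelopment`
  extend `DataEmbedding`, so `𝒟.futureEventHorizon` etc. are available by dot notation), with the
  standing Levi-Civita hypothesis `[𝒟.metric.HasLeviCivita]` taken from the context exactly as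
  `DataEmbedding.visibleRegion` and the route statements bind it; and, for cuts by data slices,
  `DataEmbedding.cutArea 𝒟 S := area D.h (ι ⁻¹' S)` (area, in the data metric `h = ι^* g`, of the
  trace of a spacetime set on the slice) and `DataEmbedding.horizonSliceCutArea 𝒟 := cutArea 𝒟 𝓗⁺`.

## Results (all proved)

* `chronologicalPast_completeNullRayRegion` : `I⁻(completeNullRayRegion) = visibleRegion`;
  `outerRegion_eq`; `futureEventHorizon_eq_frontier_blackHoleRegion` (`𝓗⁺ = ∂𝓑`);
  `causalFuture_diff_outerRegion` (`J⁺(ι X) ∖ outerRegion = 𝓑 ∩ J⁺(ι X)`, Hawking–Ellis' `ℬ(τ)`);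
* `chronologicalFuture_blackHoleRegion_subset` (`I⁺(𝓑) ⊆ 𝓑`, from `isPastSet_visibleRegion`) and,
  on a manifold without boundary, `causalFuture_blackHoleRegion_subset` (`J⁺(𝓑) ⊆ 𝓑`, push-up);
* on a manifold without boundary (in particular for every `DataEmbedding`):
  `isClosed_blackHoleRegion`, `futureEventHorizon_subset_blackHoleRegion`,
  `disjoint_futureEventHorizon_visibleRegion`, `futureEventHorizon_eq_closure_diff`
  (`𝓗⁺ = cl J⁻(𝓘⁺) ∖ J⁻(𝓘⁺)`), and **`isAchronal_futureEventHorizon`** (the event horizon is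
  achronal: Hawking–Ellis, Prop. 6.3.1);
* `CauchyDevelopment.futureEventHorizon_inter_causalFuture` : to the causal future of the data the
  intrinsic horizon **is** `CauchyDevelopment.eventHorizonOf 𝒟 𝒟.completeNullRayRegion`
  (`RedShiftedHorizon.lean`, `= ∂I⁻(U) ∩ J⁺(ι X)`), hence also `futureEventHorizonOf`
  (`RadiatedEnergy.lean`, `∂J⁻`; the two agree by `EventHorizonFrontier.lean`), so the red-shift and
  horizon-flux vocabularies apply to it verbatim; `horizonCut_eq_eventHorizonOf_inter`.

## Design choices

* **One intrinsic past of `𝓘⁺` for the whole summit.** The item suggested rendering `J⁻(𝓘⁺)`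
  through the far parts of Christodoulou's cones `C⁺(B) = ∂J⁺(ι B)` ("or any equivalent intrinsic
  form the definer can certify on Kerr"). The tree already carries the ray form `visibleRegion`
  (used verbatim by the routes `CurvatureOrSymmetry` and `BondiDrainDispersal`, whose "no event
  horizon" is `visibleRegion = univ`), so the horizon is built on it: `BondiDrainDispersal`'s
  horizonless developments are exactly those with `blackHoleRegion = ∅`, and no second vocabulary
  is opened. The cone refinement (only points swept to infinity *along* a cone `C⁺(B)` count as
  far) has the same chronological past on the model spacetimes below and is not introduced.
* **Test table (informal, model spacetimes).** *Minkowski* (`X = {t = 0}`): every straight null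
  ray from the slice is complete and every event `(t₀, x₀)` is in the timelike past of the far part
  of the ray from `(0, x₀ - Lω)` in direction `ω`, `L > t₀`; so `visibleRegion = M`, `𝓑 = ∅`,
  `𝓗⁺ = ∅`. *Schwarzschild / Kerr, `|a| < M`, collapse or two-ended data:* a future-complete null
  geodesic from the slice either escapes to `𝓘⁺` (its far part is at arbitrarily late retarded
  time and large `r`, and every exterior event precedes such far parts chronologically), or is a
  generator of `{r = r₊}` (whose chronological past is exterior), or is trapped near the photon
  region (exterior); no future-complete null geodesic enters `{r < r₊}` — in Boyer–Lindquist block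
  II `r` decreases strictly along future causal curves and Carter's radial equation
  `Σ ṙ = -√R(r)`, `R = ((r² + a²)E - aL)² - Δ(Q + (L - aE)²) > 0` on `(r₋, r₊)` with at most simple
  zeros at `r₋`, gives finite affine time to `r = r₋` (resp. `r = 0`), outside the maximal Cauchy
  development. Hence `visibleRegion = J⁻(𝓘⁺) ∩ M`, `𝓑 = {r ≤ r₊} ∩ M`, `𝓗⁺ = {r = r₊}`
  (`Kerr.futureEventHorizon` in the ingoing chart), as in O'Neill 1995, Ch. 2 and Wald §12.1.
  *What the rendering presupposes:* that the far part of every future-complete null ray from the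
  data lies in the closure of `J⁻(𝓘⁺)` — a black-hole interior containing a future-complete null
  geodesic issued from the slice would be misclassified as visible. For maximal developments of
  asymptotically flat vacuum data whose interiors terminate at singularities or Cauchy horizons
  reached in finite affine parameter this holds; it is recorded here, not asserted.
* **`𝓗⁺` and `𝓑` live on all of `M`** (the maximal development extends to the past of the slice,
  and cuts by arbitrary Cauchy slices of the same spacetime are wanted); the restriction to
  `J⁺(ι X)` is `eventHorizonOf` (`futureEventHorizon_inter_causalFuture`).
* **Chronological past and frontier.** `visibleRegion` is an `I⁻`, open and a past set with the
  tree's proved boundaryless causality (`CausalityPushUp`); `∂I⁻ = ∂J⁻` (`EventHorizonFrontier`).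
* **Areas at Lipschitz regularity.** No regularity of `𝓗⁺` or of its cuts enters the definitions:
  `area` is a Hausdorff measure. That cuts by spacelike `C²` hypersurfaces are compact Lipschitz
  surfaces (for compactly generated horizons), countably `2`-rectifiable, of finite area, is
  Chruściel–Delay–Galloway–Howard, Prop. 3.3–3.4 and Hawking–Ellis, Prop. 6.3.1 — theorems, not part
  of this vocabulary. Two area functionals are offered: `horizonCutArea` for a hypersurface
  presented as a spacelike immersion `f : N' → M` (leaves, re-embedded slices), and `cutArea` /
  `horizonSliceCutArea` for the data slice of a `DataEmbedding` in its own metric `h` (for the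
  route's slices "`𝒟' : CauchyDevelopment D'` with the same spacetime", as in
  `BlackHoleCensus.lean`, transport `𝓗⁺` along the equality of spacetimes and use `𝒟'.cutArea`).
* Definitions are stated at the metric level in the generality of `NullInfinity` (any model with
  corners, any `X`, any map `ι`) and specialised to `DataEmbedding D` by one-line wrappers, as
  `VisibleIncompleteNullRay` and `IdealPoints` do.

## What is not here (and why)

* **The area theorem** (Chruściel–Delay–Galloway–Howard 2001, Thm. 1.1 b) with Thm. 6.1: for a
  future horizon with future-complete generators on which the null energy condition holds, and
  achronal spacelike `C²` hypersurfaces `Σ₁, Σ₂` with `Σ₁ ∩ 𝓗 ⊆ J⁻(Σ₂ ∩ 𝓗)`,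
  `Ar(Σ₁ ∩ 𝓗) ≤ Ar(Σ₂ ∩ 𝓗)`) is a published theorem stated over exactly this vocabulary; it is
  vendored as a named fact in its own file (`HorizonAreaTheorem.lean`), not here (D-0026: this
  definition file mints no unproved fact).
* **"Closed trapped surfaces lie in the black-hole region"** (Hawking–Ellis 1973, Prop. 9.2.1) is
  printed for future asymptotically predictable conformal completions (with a proof questioned by
  Newman and by Chruściel–Delay–Galloway–Howard, §1); its intrinsic form over `blackHoleRegion` with
  complete `𝓘⁺` in the sojourn form as hypothesis is not a printed theorem and is therefore left to
  the route as a statement item, not vendored as a fact.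
* **Structure of `𝓗⁺`** (a future horizon in the CDGH sense whenever nonempty: Penrose's theorem
  on achronal boundaries, Hawking–Ellis Prop. 6.3.1, gives the topological-hypersurface and ruling
  properties; achronality and closedness are proved here) and **invariance under isometry of
  developments** are not asserted (the latter needs transport of maximal geodesics and unit
  normals, cf. `VisibleIncompleteNullRay`, "What is not here").

## Mathlib

Mathlib (at the pin) has `frontier`, `OpenPartialHomeomorph`, Hausdorff measures
(`MeasureTheory.Measure.hausdorffMeasure`, `euclideanHausdorffMeasure`) and the Riemannian length
metric (`Mathlib/Geometry/Manifold/Riemannian/Basic.lean`), but no Lorentzian causality, horizons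
or black holes (`rg -i 'event horizon|black hole' Mathlib` is empty). Everything else is the tree's:
`Causality` (`I^±`, `J^±`, `IsAchronal`), `CausalityPushUp` / `CausalityOpennessProofs` (proved
openness of `I^±`, push-up), `IdealPoints` (`IsPastSet`), `NullInfinity`
(`IsNormalisedNullRayFrom`), `VisibleIncompleteNullRay` (`visibleRegion`), `Hypersurface`
(`IsSpacelikeImmersion`, `inducedRiemannianMetric`), `Volume` (`area`), `CauchyDevelopment`
(`DataEmbedding`), `RedShiftedHorizon` (`eventHorizonOf`).

## References

* S. W. Hawking, G. F. R. Ellis, *The large scale structure of space-time*, CUP 1973, §6.3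
  (Prop. 6.3.1, achronal boundaries), §6.8 (past sets), §9.2 (pp. 311–318: `J⁻(𝓘⁺)`, the event
  horizon `J̇⁻(𝓘⁺)`, `ℬ(τ)`, `∂ℬ(τ)`, Prop. 9.2.1, the area theorem Prop. 9.2.7).
* R. M. Wald, *General Relativity*, Chicago 1984, §12.1, (12.1.2)–(12.1.3), §12.2 (area theorem).
* P. T. Chruściel, E. Delay, G. J. Galloway, R. Howard, *Regularity of horizons and the area
  theorem*, Ann. Henri Poincaré 2 (2001) 109–178 = arXiv:gr-qc/0001003, §2 (future horizons),
  §3 (Prop. 3.3–3.5, eq. (3.9): area of sections as Hausdorff measure), Thm. 1.1, Thm. 6.1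
  (key `ChruscielEtAl2001`).
* M. Dafermos, I. Rodnianski, *Lectures on black holes and linear waves*, arXiv:0811.0354, §2.5.4,
  §2.6.2 (key `arXiv08110354`).
* D. Christodoulou, *On the global initial value problem and the issue of singularities*, CQG 16
  (1999) A23–A35, pp. A26–A27; *The formation of black holes in general relativity*, EMS 2009 =
  arXiv:0805.3880, Prologue p. 6.
* B. O'Neill, *Semi-Riemannian geometry*, Academic Press 1983, Ch. 14 (p. 413, Cor. 14.27:
  achronal boundaries are closed topological hypersurfaces); *The geometry of Kerr black holes*,
  A K Peters 1995, Ch. 2, Ch. 4 (first integrals, block II).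
-/

open Bundle Set MeasureTheory
open scoped Manifold ContDiff Topology ENNReal

noncomputable section

namespace Literature.Geometry.Lorentzian

universe u

variable {E : Type*} [NormedAddCommGroup E] [NormedSpace ℝ E] {H : Type*} [TopologicalSpace H]
  {I : ModelWithCorners ℝ E H} {M : Type*} [TopologicalSpace M] [ChartedSpace H M]
  [IsManifold I ∞ M] {X : Type*}

/-! ### Topological hypersurfaces -/

/-- `S ⊆ M` is an (embedded) **topological hypersurface**: every point of `S` has an open
neighbourhood `U` in `M` and a homeomorphism `φ` of `U` onto an open subset of the model vector
space `E` mapping `S ∩ U` onto the trace on `φ(U)` of a closed hyperplane `{ℓ = 0}`, `ℓ ≠ 0` a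
continuous linear functional (a topological submanifold of codimension one; the `C⁰` chart `φ`
need not belong to the smooth atlas). O'Neill 1983, Ch. 14, p. 413 (topological hypersurfaces;
Cor. 14.27: an achronal boundary is a closed topological hypersurface); Chruściel–Delay–Galloway–
Howard, Ann. Henri Poincaré 2 (2001) 109, §2 ("hypersurfaces are assumed to be embedded").
[cite: ONeill1983, Ch. 14, p. 413] -/
def IsTopologicalHypersurface (S : Set M) : Prop :=
  ∀ p ∈ S, ∃ (ℓ : E →L[ℝ] ℝ) (φ : OpenPartialHomeomorph M E), ℓ ≠ 0 ∧ p ∈ φ.source ∧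
    φ '' (S ∩ φ.source) = φ.target ∩ {x | ℓ x = 0}

omit [ChartedSpace H M] in
/-- The empty set is a topological hypersurface (vacuously). [folklore] -/
lemma isTopologicalHypersurface_empty : IsTopologicalHypersurface (E := E) (∅ : Set M) :=
  fun _ h ↦ h.elim

namespace LorentzianMetric

variable (g : LorentzianMetric I ∞ M) (τ : TimeOrientation g)

/-! ### Future horizons in the sense of Chruściel–Delay–Galloway–Howard -/

section Horizons

variable [FiniteDimensional ℝ E] [g.HasLeviCivita]

/-- The set `S ⊆ M` is **future null geodesically ruled**: through every point `p ∈ S` passes a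
**generator** — a future-inextendible, future-directed null geodesic contained in `S` from `p`
onwards. Rendered with maximal geodesics of the Levi-Civita connection of `g`: there is a maximal
(inextendible in `M`) geodesic `γ` with affine domain `dom ∋ t₀`, `γ t₀ = p`, null future-directed
velocity at `t₀`, and `γ s ∈ S` for all `s ≥ t₀` in `dom` (generators may have past endpoints on
`S`, but no future endpoints). Chruściel–Delay–Galloway–Howard, Ann. Henri Poincaré 2 (2001)
109–178 = arXiv:gr-qc/0001003, §2. [cite: ChruscielEtAl2001, §2] -/
def IsFutureNullGeodesicallyRuled (S : Set M) : Prop :=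
  ∀ p ∈ S, ∃ (γ : ℝ → M) (dom : Set ℝ) (t₀ : ℝ), IsMaximalGeodesicOn g.leviCivita γ dom ∧
    t₀ ∈ dom ∧ γ t₀ = p ∧ g.IsNull (velocity I γ t₀) ∧ τ.IsFutureDirected (velocity I γ t₀) ∧
      ∀ s ∈ dom, t₀ ≤ s → γ s ∈ S

/-- The generators of `S ⊆ M` are **future complete**: every maximal geodesic of the Levi-Civita
connection which is null and future-directed at a parameter `t₀` and stays in `S` at all
parameters `s ≥ t₀` of its domain has affine domain unbounded above. Hypothesis b) of the area
theorem of Chruściel–Delay–Galloway–Howard, AHP 2 (2001) 109, Thm. 1.1 ("the generators of `𝓗`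
are future complete"). [cite: ChruscielEtAl2001, Thm. 1.1 b)] -/
def HasFutureCompleteGenerators (S : Set M) : Prop :=
  ∀ (γ : ℝ → M) (dom : Set ℝ) (t₀ : ℝ), IsMaximalGeodesicOn g.leviCivita γ dom → t₀ ∈ dom →
    g.IsNull (velocity I γ t₀) → τ.IsFutureDirected (velocity I γ t₀) →
      (∀ s ∈ dom, t₀ ≤ s → γ s ∈ S) → ¬ BddAbove dom

/-- `S ⊆ M` is a **future horizon** in the sense of Chruściel–Delay–Galloway–Howard: a closed,
achronal, future null geodesically ruled (embedded) topological hypersurface. A future black-hole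
event horizon `∂J⁻(𝓘⁺)` is a future horizon in this sense (Hawking–Ellis 1973, §9.2 with
Prop. 6.3.1). Chruściel–Delay–Galloway–Howard, AHP 2 (2001) 109, §2.
[cite: ChruscielEtAl2001, §2] -/
def IsFutureHorizon (S : Set M) : Prop :=
  IsClosed S ∧ g.IsAchronal τ S ∧ IsTopologicalHypersurface (E := E) S ∧
    g.IsFutureNullGeodesicallyRuled τ S

variable {g τ}

/-- A future horizon is closed. [folklore] -/
lemma IsFutureHorizon.isClosed {S : Set M} (h : g.IsFutureHorizon τ S) : IsClosed S :=
  h.1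

/-- A future horizon is achronal. [folklore] -/
lemma IsFutureHorizon.isAchronal {S : Set M} (h : g.IsFutureHorizon τ S) : g.IsAchronal τ S :=
  h.2.1

/-- A future horizon is a topological hypersurface. [folklore] -/
lemma IsFutureHorizon.isTopologicalHypersurface {S : Set M} (h : g.IsFutureHorizon τ S) :
    IsTopologicalHypersurface (E := E) S :=
  h.2.2.1

/-- A future horizon is future null geodesically ruled. [folklore] -/
lemma IsFutureHorizon.isFutureNullGeodesicallyRuled {S : Set M} (h : g.IsFutureHorizon τ S) :
    g.IsFutureNullGeodesicallyRuled τ S :=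
  h.2.2.2

/-- The empty set is (vacuously) future null geodesically ruled. [folklore] -/
lemma isFutureNullGeodesicallyRuled_empty : g.IsFutureNullGeodesicallyRuled τ (∅ : Set M) :=
  fun _ h ↦ h.elim

/-- The empty set has (vacuously) future complete generators. [folklore] -/
lemma hasFutureCompleteGenerators_empty : g.HasFutureCompleteGenerators τ (∅ : Set M) :=
  fun _ _ t₀ _ ht₀ _ _ hS ↦ (hS t₀ ht₀ le_rfl).elim

end Horizons

/-! ### The black-hole region and the future event horizon, intrinsically -/

section EventHorizon

variable (ι : X → M) [FiniteDimensional ℝ E] [g.HasLeviCivita] (N : NormalField I ι)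

/-- The **complete-ray region** of `(M, g, τ)` relative to the data `ι : X → M`, `N`: the union
of the nonnegative-parameter halves `δ(s ∩ [0, ∞))` of all *future-complete* normalised future null
rays `δ` from the data hypersurface (`IsNormalisedNullRayFrom`, `¬ BddAbove s`). This is the
intrinsic stand-in for (a neighbourhood in `M` of) future null infinity: its chronological past is
the visible region `visibleRegion` = `J⁻(𝓘⁺) ∩ M` (`chronologicalPast_completeNullRayRegion`),
the ideal endpoint of a complete normalised ray playing the role of a point of `𝓘⁺` as in
Christodoulou's intrinsic notion of complete future null infinity (CQG 16 (1999) A23,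
pp. A26–A27; Dafermos–Rodnianski, arXiv:0811.0354, §2.6.2 and §2.5.4). [cite: arXiv08110354, §2.5.4] -/
def completeNullRayRegion : Set M :=
  ⋃ (p : X) (δ : ℝ → M) (s : Set ℝ) (_ : g.IsNormalisedNullRayFrom τ ι N p δ s ∧ ¬ BddAbove s),
    δ '' (s ∩ Ici 0)

/-- The **black-hole region** `𝓑 := M ∖ J⁻(𝓘⁺)`, intrinsically: the complement of the visible
region `visibleRegion g τ ι N` (`VisibleIncompleteNullRay.lean`: the events in the chronological
past of the far part of a future-complete normalised null ray from the data) — the events from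
which no timelike signal reaches the far part of any complete outgoing light ray. Wald 1984,
§12.1, (12.1.2) (`B = M − J⁻(𝓘⁺)`); Hawking–Ellis 1973, §9.2, p. 312; Dafermos–Rodnianski,
arXiv:0811.0354, §2.5.4 ("if `𝓘⁺` is indeed complete, we can define the black hole region as the
complement in `M` of `J⁻(𝓘⁺)`"), rendered without conformal boundary. [cite: Wald1984, §12.1 (12.1.2)] -/
def blackHoleRegion : Set M :=
  (g.visibleRegion τ ι N)ᶜ

/-- The **future event horizon** `𝓗⁺ := ∂J⁻(𝓘⁺) = ∂𝓑`, intrinsically: the topological frontier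
in `M` of the visible region `visibleRegion g τ ι N` (equivalently of the black-hole region,
`futureEventHorizon_eq_frontier_blackHoleRegion`). Wald 1984, §12.1, (12.1.3) (`H = J̇⁻(𝓘⁺)`);
Hawking–Ellis 1973, §9.2, p. 312 (the event horizon `J̇⁻(𝓘⁺, M̄)`), rendered without conformal
boundary. To the causal future of the data it is `CauchyDevelopment.eventHorizonOf` of the
complete-ray region (`RedShiftedHorizon.lean`;
`CauchyDevelopment.futureEventHorizon_inter_causalFuture`). [cite: Wald1984, §12.1 (12.1.3)] -/
def futureEventHorizon : Set M :=
  frontier (g.visibleRegion τ ι N)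

/-- The **future domain of outer communications** (outer region) of the development to the
future of the data: `J⁺(ι X) ∩ J⁻(𝓘⁺)`, intrinsically `J⁺(range ι) ∩ visibleRegion` — the visible
events to the causal future of the data hypersurface. This is
`Summit.FinalStateConjecture.exteriorOf 𝒟 U = J⁺(ι X) ∩ I⁻(U)` at `U = completeNullRayRegion`
(`outerRegion_eq`). Hawking–Ellis 1973, §9.2; Christodoulou 2008 (arXiv:0805.3880), Prologue,
p. 6 ("the domain of outer communications being defined as the causal past of future null
infinity"); Dafermos–Rodnianski, arXiv:0811.0354, §2.5.4. [cite: HawkingEllis1973, §9.2] -/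
def outerRegion : Set M :=
  g.causalFuture τ (range ι) ∩ g.visibleRegion τ ι N

/-- The **cut of the future event horizon** by a subset `Σ ⊆ M` (a Cauchy slice, a leaf):
`𝓗⁺ ∩ Σ`. Hawking–Ellis 1973, §9.2 (`∂ℬ(τ) = J̇⁻(𝓘⁺) ∩ 𝒮(τ)`); Chruściel–Delay–Galloway–Howard,
AHP 2 (2001) 109, Thm. 1.1 (`S_a = Σ_a ∩ 𝓗`). [cite: HawkingEllis1973, §9.2] -/
def horizonCut (S : Set M) : Set M :=
  g.futureEventHorizon τ ι N ∩ S

variable {g τ ι N}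

/-- Unfolding lemma for `completeNullRayRegion`. [folklore] -/
lemma mem_completeNullRayRegion_iff {q : M} :
    q ∈ g.completeNullRayRegion τ ι N ↔ ∃ (p : X) (δ : ℝ → M) (s : Set ℝ) (t : ℝ),
      g.IsNormalisedNullRayFrom τ ι N p δ s ∧ ¬ BddAbove s ∧ t ∈ s ∧ 0 ≤ t ∧ δ t = q := by
  simp only [completeNullRayRegion, mem_iUnion, mem_image, mem_inter_iff, mem_Ici, exists_prop]
  constructor
  · rintro ⟨p, δ, s, ⟨hδ, hs⟩, t, ⟨ht, h0⟩, rfl⟩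
    exact ⟨p, δ, s, t, hδ, hs, ht, h0, rfl⟩
  · rintro ⟨p, δ, s, t, hδ, hs, ht, h0, rfl⟩
    exact ⟨p, δ, s, ⟨hδ, hs⟩, t, ⟨ht, h0⟩, rfl⟩

/-- The nonnegative half of a future-complete normalised null ray lies in the complete-ray
region. [folklore] -/
lemma image_subset_completeNullRayRegion {p : X} {δ : ℝ → M} {s : Set ℝ}
    (hδ : g.IsNormalisedNullRayFrom τ ι N p δ s) (hs : ¬ BddAbove s) :
    δ '' (s ∩ Ici 0) ⊆ g.completeNullRayRegion τ ι N := by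
  rintro _ ⟨t, ⟨ht, h0⟩, rfl⟩
  exact mem_completeNullRayRegion_iff.2 ⟨p, δ, s, t, hδ, hs, ht, h0, rfl⟩

variable (g τ ι N) in
/-- **The visible region is the chronological past of the complete-ray region**:
`I⁻(completeNullRayRegion) = visibleRegion` (`I⁻` of a union is the union of the `I⁻`). This is
the intrinsic `J⁻(𝓘⁺) ∩ M = I⁻(𝓘⁺) ∩ M`. Hawking–Ellis 1973, §9.2, p. 312. [folklore] -/
theorem chronologicalPast_completeNullRayRegion :
    g.chronologicalPast τ (g.completeNullRayRegion τ ι N) = g.visibleRegion τ ι N := by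
  ext q
  simp only [chronologicalPast, mem_chronologicalFuture_iff, mem_visibleRegion_iff,
    isVisibleEvent_iff, mem_completeNullRayRegion_iff]
  constructor
  · rintro ⟨x, ⟨p, δ, s, t, hδ, hs, ht, h0, rfl⟩, γ, a, b, hab, hγ, hγa, hγb⟩
    exact ⟨p, δ, s, hδ, hs, δ t, ⟨t, ⟨ht, h0⟩, rfl⟩, γ, a, b, hab, hγ, hγa, hγb⟩
  · rintro ⟨p, δ, s, hδ, hs, x, ⟨t, ⟨ht, h0⟩, rfl⟩, γ, a, b, hab, hγ, hγa, hγb⟩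
    exact ⟨δ t, ⟨p, δ, s, t, hδ, hs, ht, h0, rfl⟩, γ, a, b, hab, hγ, hγa, hγb⟩

/-- Membership in the black-hole region: `x ∈ 𝓑` iff `x` is not visible from infinity.
Wald 1984, §12.1. [folklore] -/
@[simp]
lemma mem_blackHoleRegion_iff {x : M} :
    x ∈ g.blackHoleRegion τ ι N ↔ ¬ g.IsVisibleEvent τ ι N x :=
  Iff.rfl

variable (g τ ι N) in
/-- The black-hole region is the complement of the visible region. [folklore] -/
lemma blackHoleRegion_eq_compl : g.blackHoleRegion τ ι N = (g.visibleRegion τ ι N)ᶜ :=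
  rfl

variable (g τ ι N) in
/-- The future event horizon is the frontier of the black-hole region: `𝓗⁺ = ∂𝓑`.
Wald 1984, (12.1.3). [cite: Wald1984, §12.1 (12.1.3)] -/
lemma futureEventHorizon_eq_frontier_blackHoleRegion :
    g.futureEventHorizon τ ι N = frontier (g.blackHoleRegion τ ι N) :=
  (frontier_compl _).symm

variable (g τ ι N) in
/-- The future event horizon is the frontier of the chronological past of the complete-ray
region: `𝓗⁺ = ∂I⁻(completeNullRayRegion)`. Hawking–Ellis 1973, §9.2. [folklore] -/
lemma futureEventHorizon_eq_frontier_chronologicalPast :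
    g.futureEventHorizon τ ι N =
      frontier (g.chronologicalPast τ (g.completeNullRayRegion τ ι N)) := by
  rw [chronologicalPast_completeNullRayRegion]
  rfl

variable (g τ ι N) in
/-- The future event horizon is closed. Hawking–Ellis 1973, §9.2. [folklore] -/
lemma isClosed_futureEventHorizon : IsClosed (g.futureEventHorizon τ ι N) :=
  isClosed_frontier

variable (g τ ι N) in
/-- The visible region and the black-hole region partition `M`. Wald 1984, §12.1. [folklore] -/
lemma visibleRegion_union_blackHoleRegion :
    g.visibleRegion τ ι N ∪ g.blackHoleRegion τ ι N = univ :=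
  union_compl_self _

variable (g τ ι N) in
/-- The visible region is disjoint from the black-hole region. Wald 1984, §12.1. [folklore] -/
lemma disjoint_visibleRegion_blackHoleRegion :
    Disjoint (g.visibleRegion τ ι N) (g.blackHoleRegion τ ι N) :=
  disjoint_compl_right

variable (g τ ι N) in
/-- The outer region consists of visible events. [folklore] -/
lemma outerRegion_subset_visibleRegion : g.outerRegion τ ι N ⊆ g.visibleRegion τ ι N :=
  inter_subset_right

variable (g τ ι N) in
/-- The outer region lies to the causal future of the data. [folklore] -/
lemma outerRegion_subset_causalFuture : g.outerRegion τ ι N ⊆ g.causalFuture τ (range ι) :=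
  inter_subset_left

variable (g τ ι N) in
/-- The outer region is `J⁺(ι X) ∩ I⁻(completeNullRayRegion)`, i.e. the final-state statement's
`exteriorOf` at the complete-ray region. [folklore] -/
lemma outerRegion_eq :
    g.outerRegion τ ι N =
      g.causalFuture τ (range ι) ∩ g.chronologicalPast τ (g.completeNullRayRegion τ ι N) := by
  rw [chronologicalPast_completeNullRayRegion]
  rfl

variable (g τ ι N) in
/-- The outer region is disjoint from the black-hole region. Wald 1984, §12.1. [folklore] -/
lemma disjoint_outerRegion_blackHoleRegion :
    Disjoint (g.outerRegion τ ι N) (g.blackHoleRegion τ ι N) :=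
  disjoint_compl_right.mono_left inter_subset_right

variable (g τ ι N) in
/-- The causal future of the data splits into the outer region and the part of the black-hole
region to the future of the data: `J⁺(ι X) ∖ outerRegion = 𝓑 ∩ J⁺(ι X)` — Hawking–Ellis' black
hole on a slice, `ℬ(τ) = 𝒮(τ) − J⁻(𝓘⁺)` (1973, §9.2, p. 315 ff.). [folklore] -/
lemma causalFuture_diff_outerRegion :
    g.causalFuture τ (range ι) \ g.outerRegion τ ι N =
      g.blackHoleRegion τ ι N ∩ g.causalFuture τ (range ι) := by
  ext x
  simp only [outerRegion, blackHoleRegion, mem_sdiff, mem_inter_iff, mem_compl_iff, not_and,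
    mem_visibleRegion_iff]
  tauto

/-- **The black-hole region is a future set**: `I⁺(𝓑) ⊆ 𝓑` — if `x ∈ 𝓑` and `x ≪ y` with `y`
visible then `x` would be visible (the visible region is a past set, `isPastSet_visibleRegion`).
Hawking–Ellis 1973, §9.2; Wald 1984, §12.1. [folklore] -/
theorem chronologicalFuture_blackHoleRegion_subset :
    g.chronologicalFuture τ (g.blackHoleRegion τ ι N) ⊆ g.blackHoleRegion τ ι N := by
  rintro y ⟨x, hx, hxy⟩ hy
  exact hx (IsVisibleEvent.of_mem_chronologicalPast hy
    (mem_chronologicalPast_of_mem_chronologicalFuture ⟨x, rfl, hxy⟩))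

variable (ι N) in
/-- The horizon cut by `Σ` lies on the horizon. [folklore] -/
lemma horizonCut_subset_futureEventHorizon (S : Set M) :
    g.horizonCut τ ι N S ⊆ g.futureEventHorizon τ ι N :=
  inter_subset_left

variable (ι N) in
/-- The horizon cut by `Σ` lies in `Σ`. [folklore] -/
lemma horizonCut_subset (S : Set M) : g.horizonCut τ ι N S ⊆ S :=
  inter_subset_right

variable (ι N) in
/-- Cuts are monotone in the cutting set. [folklore] -/
lemma horizonCut_mono {S S' : Set M} (h : S ⊆ S') : g.horizonCut τ ι N S ⊆ g.horizonCut τ ι N S' :=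
  inter_subset_inter_right _ h

variable (ι N) in
/-- The trace of the horizon on a hypersurface `f : N' → M` is the preimage of the cut of the
horizon by its image: `f ⁻¹(𝓗⁺ ∩ f(N')) = f ⁻¹(𝓗⁺)`. [folklore] -/
lemma preimage_horizonCut_range {N' : Type*} (f : N' → M) :
    f ⁻¹' g.horizonCut τ ι N (range f) = f ⁻¹' g.futureEventHorizon τ ι N := by
  ext y
  simp [horizonCut]

section Boundaryless

variable [BoundarylessManifold I M]

variable (g τ ι N) in
/-- On a manifold without boundary **the black-hole region is closed** (the visible region is
open, `isOpen_visibleRegion`). Wald 1984, §12.1. [folklore] -/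
lemma isClosed_blackHoleRegion : IsClosed (g.blackHoleRegion τ ι N) :=
  (isOpen_visibleRegion g τ ι N).isClosed_compl

variable (g τ ι N) in
/-- On a manifold without boundary the future event horizon lies in the black-hole region
(`𝓑` is closed and `𝓗⁺ = ∂𝓑`). Wald 1984, §12.1. [folklore] -/
lemma futureEventHorizon_subset_blackHoleRegion :
    g.futureEventHorizon τ ι N ⊆ g.blackHoleRegion τ ι N := by
  rw [futureEventHorizon_eq_frontier_blackHoleRegion]
  exact (isClosed_blackHoleRegion g τ ι N).frontier_subset

variable (g τ ι N) in
/-- On a manifold without boundary the future event horizon is disjoint from the visible region.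
Wald 1984, §12.1. [folklore] -/
lemma disjoint_futureEventHorizon_visibleRegion :
    Disjoint (g.futureEventHorizon τ ι N) (g.visibleRegion τ ι N) :=
  Set.disjoint_left.2 fun _ hx hx' ↦ futureEventHorizon_subset_blackHoleRegion g τ ι N hx hx'

variable (g τ ι N) in
/-- On a manifold without boundary `𝓗⁺ = closure (J⁻(𝓘⁺)) ∖ J⁻(𝓘⁺)` (the visible region is
open). Hawking–Ellis 1973, §9.2. [folklore] -/
lemma futureEventHorizon_eq_closure_diff :
    g.futureEventHorizon τ ι N = closure (g.visibleRegion τ ι N) \ g.visibleRegion τ ι N := by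
  rw [futureEventHorizon, frontier, (isOpen_visibleRegion g τ ι N).interior_eq]

variable (g τ ι N) in
/-- **The future event horizon is achronal** (on a manifold without boundary): if `x, y ∈ 𝓗⁺`
with `x ≪ y`, then `I⁺(x)` is an open neighbourhood of `y ∈ closure (J⁻(𝓘⁺))`, so it meets the
visible region, whence `x` is visible (the visible region is a past set) — but `𝓗⁺` is disjoint
from the visible region. Hawking–Ellis 1973, Prop. 6.3.1 (achronal boundaries) and §9.2; Wald
1984, §12.1. [folklore] -/
theorem isAchronal_futureEventHorizon : g.IsAchronal τ (g.futureEventHorizon τ ι N) := by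
  intro x hx y hy hxy
  have hyc : y ∈ closure (g.visibleRegion τ ι N) := by
    rw [futureEventHorizon_eq_closure_diff] at hy
    exact hy.1
  obtain ⟨z, hzI, hzV⟩ := mem_closure_iff_nhds.mp hyc _
    ((isOpen_chronologicalFuture_of_boundaryless g τ {x}).mem_nhds hxy)
  exact Set.disjoint_left.1 (disjoint_futureEventHorizon_visibleRegion g τ ι N) hx
    (IsVisibleEvent.of_mem_chronologicalPast hzV
      (mem_chronologicalPast_of_mem_chronologicalFuture hzI))

/-- **The black-hole region is a future set for the causal relation** (manifold without
boundary): `J⁺(𝓑) ⊆ 𝓑` — if `x ∈ 𝓑`, `x ≤ y` and `y ≪ z` with `z` on the far part of a complete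
ray, then `x ≪ z` by push-up (`mem_chronologicalFuture_of_mem_causalFuture`, O'Neill 1983,
Ch. 14, Cor. 14.1), so `x` would be visible. Hawking–Ellis 1973, §9.2; Wald 1984, §12.1
(12.1.2). [folklore] -/
theorem causalFuture_blackHoleRegion_subset :
    g.causalFuture τ (g.blackHoleRegion τ ι N) ⊆ g.blackHoleRegion τ ι N := by
  intro y hy hyV
  rw [causalFuture_eq_biUnion] at hy
  simp only [mem_iUnion, exists_prop] at hy
  obtain ⟨x, hx, hxy⟩ := hy
  obtain ⟨p, δ, s, hδ, hs, z, hz, γ, a, b, hab, hγ, hγa, hγb⟩ := hyV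
  have hzy : y ∈ g.chronologicalPast τ {z} := ⟨z, rfl, γ, a, b, hab, hγ, hγa, hγb⟩
  have hn : (1 : ℕ∞ω) ≤ ((⊤ : ℕ∞) : ℕ∞ω) := by exact_mod_cast le_top
  have hzx : z ∈ g.chronologicalFuture τ {x} :=
    mem_chronologicalFuture_of_mem_causalFuture hn hxy
      (mem_chronologicalFuture_of_mem_chronologicalPast hzy)
  exact hx ⟨p, δ, s, hδ, hs, chronologicalPast_mono (singleton_subset_iff.2 hz)
    (mem_chronologicalPast_of_mem_chronologicalFuture hzx)⟩

variable (g τ ι N) in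
/-- On a manifold without boundary the horizon cut by any set lies in the black-hole region.
[folklore] -/
lemma horizonCut_subset_blackHoleRegion (S : Set M) :
    g.horizonCut τ ι N S ⊆ g.blackHoleRegion τ ι N :=
  (horizonCut_subset_futureEventHorizon ι N S).trans
    (futureEventHorizon_subset_blackHoleRegion g τ ι N)

end Boundaryless

end EventHorizon

/-! ### Areas of cuts of the horizon by spacelike hypersurfaces -/

section CutArea

variable (ι : X → M) [FiniteDimensional ℝ E] [g.HasLeviCivita] (N : NormalField I ι)
  {E' : Type*} [NormedAddCommGroup E'] [NormedSpace ℝ E'] [FiniteDimensional ℝ E']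
  {H' : Type*} [TopologicalSpace H'] {I' : ModelWithCorners ℝ E' H'}
  {N' : Type*} [TopologicalSpace N'] [ChartedSpace H' N'] [IsManifold I' ∞ N'] [T3Space N']
  [MeasurableSpace N'] [BorelSpace N']

/-- The **area of the cut of the future event horizon by a spacelike hypersurface**
`f : N' → M` (a spacelike immersion, `IsSpacelikeImmersion`; typically an embedded spacelike
slice or leaf of dimension `dim M - 1`): the `2`-dimensional Euclidean-normalised Hausdorff measure
(`area`, `Volume.lean`), for the length metric of the induced Riemannian metric `f^* g`
(`inducedRiemannianMetric`, smoothness hypothesis `hpb`), of the trace `f ⁻¹(𝓗⁺) ⊆ N'` of the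
horizon on the hypersurface. This is the area `Ar(S) = ℌ^{n-1}_h(S)` of the section
`S = Σ ∩ 𝓗` used in the area theorem — Chruściel–Delay–Galloway–Howard, AHP 2 (2001) 109, §3,
eq. (3.9) ("precisely the `(n-1)` dimensional Hausdorff measure `ℌ^{n-1}_h` of `S`", `h` the
metric induced on `Σ` by `g`), Prop. 3.3 (`Σ ∩ 𝓗` is Borel) — here in spacetime dimension `4`
(`n - 1 = 2`); no differentiability of `𝓗⁺` is needed. Hawking–Ellis 1973, §9.2 (area of
`∂ℬ(τ)`). [cite: ChruscielEtAl2001, §3 eq. (3.9)] -/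
def horizonCutArea (f : N' → M) (hpb : PseudoRiemannianMetric.contMDiff_pullbackBilin I M I' N' ∞)
    (hf : g.IsSpacelikeImmersion I' f) : ℝ≥0∞ :=
  area (g.inducedRiemannianMetric f hpb hf) (f ⁻¹' g.futureEventHorizon τ ι N)

variable {g τ ι N}

/-- Unfolding lemma for `horizonCutArea`. [folklore] -/
lemma horizonCutArea_eq (f : N' → M) (hpb : PseudoRiemannianMetric.contMDiff_pullbackBilin I M I' N' ∞)
    (hf : g.IsSpacelikeImmersion I' f) :
    g.horizonCutArea τ ι N f hpb hf =
      area (g.inducedRiemannianMetric f hpb hf) (f ⁻¹' g.futureEventHorizon τ ι N) :=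
  rfl

end CutArea

end LorentzianMetric

/-! ### Data embeddings and Cauchy developments -/

namespace DataEmbedding

variable {n : ℕ} {X : Type u} [TopologicalSpace X] [ChartedSpace (EuclideanSpace ℝ (Fin n)) X]
  [IsManifold (𝓡 n) ∞ X] [ConnectedSpace X] {D : InitialDataSet (𝓡 n) X}

/-- The **complete-ray region** of the data embedding / Cauchy development
`𝒟 = (M, g, τ, ι, ν)`: `LorentzianMetric.completeNullRayRegion` for the fields of `𝒟` — the union
of the nonnegative halves of the future-complete normalised null rays from `ι(X)`, the intrinsic
stand-in for `𝓘⁺` (its chronological past is `𝒟.visibleRegion`,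
`chronologicalPast_completeNullRayRegion`). The standing Levi-Civita hypothesis
`[𝒟.metric.HasLeviCivita]` is taken from the context, as in `DataEmbedding.visibleRegion`; for
`𝒟 : CauchyDevelopment D` or `VacuumCauchyDevelopment D` write `𝒟.completeNullRayRegion`.
Dafermos–Rodnianski, arXiv:0811.0354, §2.5.4, §2.6.2. [cite: arXiv08110354, §2.5.4] -/
def completeNullRayRegion (𝒟 : DataEmbedding D) [𝒟.metric.HasLeviCivita] : Set 𝒟.carrier :=
  𝒟.metric.completeNullRayRegion 𝒟.timeOrientation 𝒟.embed 𝒟.normal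

/-- The **black-hole region** `𝓑 = M ∖ J⁻(𝓘⁺)` of the data embedding / Cauchy development `𝒟`,
intrinsically: the complement of its visible region `𝒟.visibleRegion`
(`LorentzianMetric.blackHoleRegion` for the fields of `𝒟`). Wald 1984, §12.1, (12.1.2);
Hawking–Ellis 1973, §9.2, p. 312. [cite: Wald1984, §12.1 (12.1.2)] -/
def blackHoleRegion (𝒟 : DataEmbedding D) [𝒟.metric.HasLeviCivita] : Set 𝒟.carrier :=
  𝒟.metric.blackHoleRegion 𝒟.timeOrientation 𝒟.embed 𝒟.normal

/-- The **future event horizon** `𝓗⁺ = ∂J⁻(𝓘⁺)` of the data embedding / Cauchy development `𝒟`,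
intrinsically: the frontier of its visible region (`LorentzianMetric.futureEventHorizon` for the
fields of `𝒟`). Wald 1984, §12.1, (12.1.3); Hawking–Ellis 1973, §9.2, p. 312.
[cite: Wald1984, §12.1 (12.1.3)] -/
def futureEventHorizon (𝒟 : DataEmbedding D) [𝒟.metric.HasLeviCivita] : Set 𝒟.carrier :=
  𝒟.metric.futureEventHorizon 𝒟.timeOrientation 𝒟.embed 𝒟.normal

/-- The **future domain of outer communications** `J⁺(ι X) ∩ J⁻(𝓘⁺)` of the data embedding /
Cauchy development `𝒟`, intrinsically (`LorentzianMetric.outerRegion` for the fields of `𝒟`).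
Hawking–Ellis 1973, §9.2; Christodoulou 2008, Prologue, p. 6. [cite: HawkingEllis1973, §9.2] -/
def outerRegion (𝒟 : DataEmbedding D) [𝒟.metric.HasLeviCivita] : Set 𝒟.carrier :=
  𝒟.metric.outerRegion 𝒟.timeOrientation 𝒟.embed 𝒟.normal

/-- The **cut of the future event horizon** of `𝒟` by a subset `Σ` of spacetime: `𝓗⁺ ∩ Σ`.
Hawking–Ellis 1973, §9.2. [cite: HawkingEllis1973, §9.2] -/
def horizonCut (𝒟 : DataEmbedding D) [𝒟.metric.HasLeviCivita] (S : Set 𝒟.carrier) :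
    Set 𝒟.carrier :=
  𝒟.metric.horizonCut 𝒟.timeOrientation 𝒟.embed 𝒟.normal S

section CutArea

variable {E' : Type*} [NormedAddCommGroup E'] [NormedSpace ℝ E'] [FiniteDimensional ℝ E']
  {H' : Type*} [TopologicalSpace H'] {I' : ModelWithCorners ℝ E' H'}
  {N' : Type*} [TopologicalSpace N'] [ChartedSpace H' N'] [IsManifold I' ∞ N'] [T3Space N']
  [MeasurableSpace N'] [BorelSpace N']

/-- The **area of the cut of the future event horizon of `𝒟` by a spacelike hypersurface**
`f : N' → M` (a spacelike immersion of a `3`-manifold — a Cauchy slice, a leaf — into the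
spacetime of `𝒟`): the `2`-dimensional Euclidean-normalised Hausdorff measure of `f ⁻¹(𝓗⁺)` for
the length metric of `f^* g` (`LorentzianMetric.horizonCutArea` for the fields of `𝒟`).
Chruściel–Delay–Galloway–Howard, AHP 2 (2001) 109, §3, eq. (3.9); Hawking–Ellis 1973, §9.2.
[cite: ChruscielEtAl2001, §3 eq. (3.9)] -/
def horizonCutArea (𝒟 : DataEmbedding D) [𝒟.metric.HasLeviCivita] (f : N' → 𝒟.carrier)
    (hpb : PseudoRiemannianMetric.contMDiff_pullbackBilin (𝓡 (n + 1)) 𝒟.carrier I' N' ∞)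
    (hf : 𝒟.metric.IsSpacelikeImmersion I' f) : ℝ≥0∞ :=
  𝒟.metric.horizonCutArea 𝒟.timeOrientation 𝒟.embed 𝒟.normal f hpb hf

end CutArea

/-- The **area of the cut of a spacetime set `S` by the data slice `ι(X)`**, measured in the
data metric `h`: the `2`-dimensional Euclidean-normalised Hausdorff measure (`area D.h`,
`Volume.lean`) of the trace `ι ⁻¹(S) ⊆ X`. Since `ι^* g = h` (`induced_h`) this is the area of
`S ∩ ι(X)` in the metric induced by `g` on the slice, the quantity of Hawking–Ellis 1973, §9.2
(area of `∂ℬ(τ) ⊆ 𝒮(τ)`) and Chruściel–Delay–Galloway–Howard 2001, §3, eq. (3.9). Used with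
`S` the future event horizon of a development of which `𝒟` presents a Cauchy slice (same
spacetime), or a union of components of one of its cuts. [cite: HawkingEllis1973, §9.2] -/
def cutArea (𝒟 : DataEmbedding D) [T3Space X] [MeasurableSpace X] [BorelSpace X]
    (S : Set 𝒟.carrier) : ℝ≥0∞ :=
  area D.h (𝒟.embed ⁻¹' S)

/-- The **area of the cut of the future event horizon of `𝒟` by its own data slice `ι(X)`**, in
the data metric: `cutArea 𝒟 𝒟.futureEventHorizon = area h (ι ⁻¹(𝓗⁺))`. Hawking–Ellis 1973,
§9.2. [cite: HawkingEllis1973, §9.2] -/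
def horizonSliceCutArea (𝒟 : DataEmbedding D) [𝒟.metric.HasLeviCivita] [T3Space X]
    [MeasurableSpace X] [BorelSpace X] : ℝ≥0∞ :=
  𝒟.cutArea 𝒟.futureEventHorizon

variable (𝒟 : DataEmbedding D) [𝒟.metric.HasLeviCivita]

/-- Membership in the black-hole region of `𝒟`: not visible from infinity. [folklore] -/
@[simp]
lemma mem_blackHoleRegion_iff {q : 𝒟.carrier} : q ∈ 𝒟.blackHoleRegion ↔ ¬ 𝒟.IsVisibleEvent q :=
  Iff.rfl

/-- The black-hole region of `𝒟` is the complement of its visible region. [folklore] -/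
lemma blackHoleRegion_eq_compl : 𝒟.blackHoleRegion = (𝒟.visibleRegion)ᶜ :=
  rfl

/-- The future event horizon of `𝒟` is the frontier of its visible region. [folklore] -/
lemma futureEventHorizon_eq_frontier : 𝒟.futureEventHorizon = frontier 𝒟.visibleRegion :=
  rfl

/-- The future event horizon of `𝒟` is the frontier of its black-hole region. Wald 1984,
(12.1.3). [folklore] -/
lemma futureEventHorizon_eq_frontier_blackHoleRegion :
    𝒟.futureEventHorizon = frontier 𝒟.blackHoleRegion :=
  LorentzianMetric.futureEventHorizon_eq_frontier_blackHoleRegion _ _ _ _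

/-- The visible region of `𝒟` is the chronological past of its complete-ray region. [folklore] -/
lemma chronologicalPast_completeNullRayRegion :
    𝒟.metric.chronologicalPast 𝒟.timeOrientation 𝒟.completeNullRayRegion = 𝒟.visibleRegion :=
  LorentzianMetric.chronologicalPast_completeNullRayRegion _ _ _ _

/-- The outer region of `𝒟` is `J⁺(ι X) ∩ I⁻(completeNullRayRegion)` — the final-state
statement's `exteriorOf 𝒟 U` at `U = 𝒟.completeNullRayRegion`. [folklore] -/
lemma outerRegion_eq :
    𝒟.outerRegion = 𝒟.metric.causalFuture 𝒟.timeOrientation (range 𝒟.embed) ∩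
      𝒟.metric.chronologicalPast 𝒟.timeOrientation 𝒟.completeNullRayRegion :=
  LorentzianMetric.outerRegion_eq _ _ _ _

/-- Unfolding lemma for `horizonCut`. [folklore] -/
lemma horizonCut_eq (S : Set 𝒟.carrier) : 𝒟.horizonCut S = 𝒟.futureEventHorizon ∩ S :=
  rfl

/-- Unfolding lemma for `horizonSliceCutArea`. [folklore] -/
lemma horizonSliceCutArea_eq [T3Space X] [MeasurableSpace X] [BorelSpace X] :
    𝒟.horizonSliceCutArea = area D.h (𝒟.embed ⁻¹' 𝒟.futureEventHorizon) :=
  rfl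

/-- The future event horizon of `𝒟` is closed. [folklore] -/
lemma isClosed_futureEventHorizon : IsClosed 𝒟.futureEventHorizon :=
  isClosed_frontier

/-- **The black-hole region of `𝒟` is closed** (spacetime carriers have no boundary).
Wald 1984, §12.1. [folklore] -/
lemma isClosed_blackHoleRegion : IsClosed 𝒟.blackHoleRegion :=
  LorentzianMetric.isClosed_blackHoleRegion _ _ _ _

/-- The future event horizon of `𝒟` lies in its black-hole region. Wald 1984, §12.1.
[folklore] -/
lemma futureEventHorizon_subset_blackHoleRegion : 𝒟.futureEventHorizon ⊆ 𝒟.blackHoleRegion :=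
  LorentzianMetric.futureEventHorizon_subset_blackHoleRegion _ _ _ _

/-- The future event horizon of `𝒟` is disjoint from its visible region. [folklore] -/
lemma disjoint_futureEventHorizon_visibleRegion :
    Disjoint 𝒟.futureEventHorizon 𝒟.visibleRegion :=
  LorentzianMetric.disjoint_futureEventHorizon_visibleRegion _ _ _ _

/-- **The future event horizon of `𝒟` is achronal.** Hawking–Ellis 1973, Prop. 6.3.1 and §9.2.
[folklore] -/
theorem isAchronal_futureEventHorizon :
    𝒟.metric.IsAchronal 𝒟.timeOrientation 𝒟.futureEventHorizon :=
  LorentzianMetric.isAchronal_futureEventHorizon _ _ _ _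

/-- **The black-hole region of `𝒟` is a future set**: `J⁺(𝓑) ⊆ 𝓑`. Wald 1984, §12.1.
[folklore] -/
theorem causalFuture_blackHoleRegion_subset :
    𝒟.metric.causalFuture 𝒟.timeOrientation 𝒟.blackHoleRegion ⊆ 𝒟.blackHoleRegion :=
  LorentzianMetric.causalFuture_blackHoleRegion_subset

end DataEmbedding

namespace CauchyDevelopment

variable {n : ℕ} {X : Type u} [TopologicalSpace X] [ChartedSpace (EuclideanSpace ℝ (Fin n)) X]
  [IsManifold (𝓡 n) ∞ X] [ConnectedSpace X] {D : InitialDataSet (𝓡 n) X}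

/-- **To the causal future of the data, the intrinsic event horizon is the event horizon of the
complete-ray region** in the sense of `RedShiftedHorizon.lean`:
`𝓗⁺ ∩ J⁺(ι X) = 𝒟.eventHorizonOf 𝒟.completeNullRayRegion = ∂I⁻(completeNullRayRegion) ∩ J⁺(ι X)`
(and hence also `𝒟.futureEventHorizonOf 𝒟.completeNullRayRegion`, `EventHorizonFrontier.lean`).
Hawking–Ellis 1973, §9.2. [folklore] -/
theorem futureEventHorizon_inter_causalFuture (𝒟 : CauchyDevelopment D) [𝒟.metric.HasLeviCivita] :
    𝒟.futureEventHorizon ∩ 𝒟.metric.causalFuture 𝒟.timeOrientation (range 𝒟.embed) =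
      𝒟.eventHorizonOf 𝒟.completeNullRayRegion := by
  rw [eventHorizonOf, DataEmbedding.chronologicalPast_completeNullRayRegion]
  rfl

/-- The horizon cut of `𝒟` by a set to the causal future of the data is the corresponding cut of
`𝒟.eventHorizonOf 𝒟.completeNullRayRegion`. [folklore] -/
theorem horizonCut_eq_eventHorizonOf_inter (𝒟 : CauchyDevelopment D) [𝒟.metric.HasLeviCivita]
    {S : Set 𝒟.carrier} (hS : S ⊆ 𝒟.metric.causalFuture 𝒟.timeOrientation (range 𝒟.embed)) :
    𝒟.horizonCut S = 𝒟.eventHorizonOf 𝒟.completeNullRayRegion ∩ S := by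
  rw [← futureEventHorizon_inter_causalFuture, DataEmbedding.horizonCut_eq, inter_assoc,
    inter_eq_right.2 hS]

end CauchyDevelopment

end Literature.Geometry.Lorentzian

end
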